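import Literature.NumberTheory.Sieve.MaynardSieveKernel
import Mathlib.NumberTheory.Primorial
import HarnessLib

/-!
# Maynard–Tao sieve: Lemma 5.1 (the sum `S₁`)

J. Maynard, *Small gaps between primes*, Ann. of Math. (2) 181 (2015), 383–413 = arXiv:1311.4600,
Lemma 5.1: with `λ_d` defined from the `y`-variables by (5.8)/(5.10),
`S₁ = ∑_{N ≤ n < 2N, n ≡ v₀ (W)} (∑_{dᵢ ∣ n+hᵢ} λ_d)² = (N/W) ∑_r y_r² / ∏φ(rᵢ)
  + O(y_max² N (log R)^k / (W D₀) + y_max² R² (log R)^{4k})`.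

This file proves Lemma 5.1 in the form `abs_S1_sub_main_le`, for the encoding of sieve tuples by
functional finsets of (prime, index) pairs (`MaynardSieveTuples`) and with `W = D₀#` for a *fixed*
`D₀ ≥ 8k²` (all of Maynard's uses of `D₀ → ∞` are through error terms `O(1/D₀)`, which we keep
explicit). It is part of the fixed-`D₀` route to `Literature.NumberTheory.Sieve.frequently_card_primes_ge_of_maynardFunctional_smooth`
(`MaynardSieveKernel` → this file → `MaynardSieveTupleS2`); the tree's other route vendors Lemma 5.1
as the named fact `Literature.NumberTheory.Sieve.maynard_lemma51` (`MaynardSieveS1.lean`, `D₀ = log log log N`, tuples of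
integers, with the bilinear algebra proved in `MaynardSieveBilinear.lean`). The present statement is
not that fact (different normalisation and encoding) but the same printed lemma:

`|S₁ − (N/W) ∑_A y_A²/φ(A)| ≤ (N/W) · y_max² (8k²/D₀) ∑_A 1/φ(A) + y_max² R² (1 + log R)^{6k−2}`.

Steps (sections below):
* `Setup`: `φ(A)`, `λ_B` (`lam`), the divisibility condition, the sieve term, `S₁`, `Σ'₁`;
* `CRTStep` (first display of the proof and (5.2)): incompatible pairs `(d, e)` contribute nothing
  (`not_divides_of_not_isFunctional`, using that the shifts are distinct with differences `≤ D₀`),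
  compatible pairs contribute `N/(W ∏ p) + O(1)` (`abs_card_filter_divides_sub_le`, Chinese
  remainder theorem), whence `|S₁ − (N/W) Σ'₁| ≤ (∑_d |λ_d|)²` (`abs_S1_sub_mainSum1_le`);
* `Diagonal` ((5.5)–(5.8)): substituting `λ` in terms of `y` and exchanging summations,
  `Σ'₁ = ∑_{A,A'} y_A y_{A'} K(A,A')/(φ(A)φ(A'))` with the kernel of `MaynardSieveKernel`, and
  `K(A, A') = [same primes] ∏_p (p − 1 or −1)`, `K(A, A) = φ(A)`;
* `OffDiagonal` ((5.13)–(5.15), Maynard's `s_{i,j} > D₀`): pairs `A ≠ A'` with the same primes are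
  bounded by peeling the least prime with mismatched indices: their total weight is at most
  `(8k²/D₀) ∑_A 1/φ(A)` (`sum_offW_le`);
* `Conclusion`: `∑_d |λ_d| ≤ y_max R (1 + log R)^{3k−1}` ((5.4), (5.9), via
  `sum_tuplesProd_three_pow_le` and `card_prodLeTuples_le`) and the final estimate.

## References

* J. Maynard, *Small gaps between primes*, Ann. of Math. (2) 181 (2015), 383–413,
  doi:10.4007/annals.2015.181.1.7 = arXiv:1311.4600; Lemma 5.1 and its proof, (5.1)–(5.15).
  [cite: MaynardAnnals2015]
-/

open Finset

namespace Literature.NumberTheory.Sieve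
namespace MaynardTao


/-- `∑_{D < n ≤ x} 1/n² ≤ 1/D` for `D ≥ 1` (telescoping). [folklore] -/
theorem sum_Ioc_one_div_sq_le {D : ℕ} (hD : 0 < D) (x : ℕ) :
    ∑ n ∈ Ioc D x, (1:ℝ) / (n : ℝ) ^ 2 ≤ 1 / D := by
  have key : ∀ x, D ≤ x → ∑ n ∈ Ioc D x, (1:ℝ) / (n : ℝ) ^ 2 ≤ 1 / D - 1 / x := by
    intro x hx
    induction x, hx using Nat.le_induction with
    | base => simp
    | succ y hy ih =>
      rw [Finset.sum_Ioc_succ_top hy]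
      · have hy0 : (0:ℝ) < y := by exact_mod_cast hD.trans_le hy
        have h1 : (1:ℝ) / ((y + 1 : ℕ) : ℝ) ^ 2 ≤ 1 / y - 1 / ((y + 1 : ℕ) : ℝ) := by
          push_cast
          rw [div_sub_div _ _ hy0.ne' (by positivity), div_le_div_iff₀ (by positivity) (by positivity)]
          nlinarith
        linarith
  have := key (max D x) (le_max_left _ _)
  have hsub : Ioc D x ⊆ Ioc D (max D x) := Finset.Ioc_subset_Ioc le_rfl (le_max_right _ _)
  calc ∑ n ∈ Ioc D x, (1:ℝ) / (n : ℝ) ^ 2 ≤ ∑ n ∈ Ioc D (max D x), (1:ℝ) / (n : ℝ) ^ 2 :=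
        Finset.sum_le_sum_of_subset_of_nonneg hsub fun n _ _ => by positivity
    _ ≤ 1 / D - 1 / (max D x : ℕ) := this
    _ ≤ 1 / D := by simp only [sub_le_self_iff]; positivity

/-! ### The sieve set-up: `y`, `λ`, the sieve terms and `S₁` -/

section Setup

variable {k : ℕ}

/-- `φ(A) = ∏_{(p, i) ∈ A} (p − 1)`, i.e. `∏ᵢ φ(rᵢ)` for the tuple encoded by `A`.
[cite: MaynardAnnals2015, Lemma 5.1] -/
noncomputable def phiA (A : Finset (ℕ × Fin k)) : ℝ := ∏ x ∈ A, ((x.1 : ℝ) - 1)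

/-- `∏_{(p, i) ∈ B} p`, i.e. `∏ᵢ dᵢ` for the divisor tuple encoded by `B`.
[cite: MaynardAnnals2015, Lemma 5.1] -/
noncomputable def prodA (B : Finset (ℕ × Fin k)) : ℝ := ∏ x ∈ B, (x.1 : ℝ)

/-- Maynard's sieve weights `λ_{d_1,…,d_k}` defined from the `y`-variables by
`λ_d = (∏ᵢ μ(dᵢ) dᵢ) ∑_{r : dᵢ ∣ rᵢ} y_r / ∏ᵢ φ(rᵢ)` (Maynard 2015, (5.10) inverted = (5.8),
and (6.3); the tree's `maynardWeight` with `y = F(log r / log R)`), in the pair encoding: `B` the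
divisor tuple, `A ⊇ B` the support tuples. [cite: MaynardAnnals2015, Lemma 5.1, (5.8)–(5.10)] -/
noncomputable def lam (D₀ Rn : ℕ) (y : Finset (ℕ × Fin k) → ℝ) (B : Finset (ℕ × Fin k)) : ℝ :=
  (-1 : ℝ) ^ B.card * prodA B *
    ∑ A ∈ (tuplesProd k D₀ Rn).filter (fun A => B ⊆ A), y A / phiA A

/-- The divisibility condition "`dᵢ ∣ n + hᵢ` for all `i`" for the divisor tuple `B`.
[cite: MaynardAnnals2015, (4.2)] -/
def Divides (h : Fin k → ℤ) (B : Finset (ℕ × Fin k)) (n : ℤ) : Prop :=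
  ∀ x ∈ B, ((x.1 : ℕ) : ℤ) ∣ n + h x.2

/-- Decidability of the divisibility condition. [folklore] -/
instance (h : Fin k → ℤ) (B : Finset (ℕ × Fin k)) (n : ℤ) : Decidable (Divides h B n) := by
  unfold Divides; infer_instance

/-- The sieve term `∑_{dᵢ ∣ n + hᵢ ∀ i} λ_{d_1,…,d_k}` (Maynard 2015, (2.4), (4.2)).
[cite: MaynardAnnals2015, (4.2)] -/
noncomputable def sieveTerm (D₀ Rn : ℕ) (y : Finset (ℕ × Fin k) → ℝ) (h : Fin k → ℤ) (n : ℤ) : ℝ :=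
  ∑ B ∈ tuplesProd k D₀ Rn, if Divides h B n then lam D₀ Rn y B else 0

/-- The integers `N ≤ n < 2N` with `n ≡ v₀ (mod W)` (Maynard 2015, (4.2)–(4.3)).
[cite: MaynardAnnals2015, (4.2)] -/
noncomputable def sieveRange (W N : ℕ) (v₀ : ℤ) : Finset ℤ :=
  (Finset.Ico (N : ℤ) (2 * N)).filter (fun n => n ≡ v₀ [ZMOD W])

/-- `S₁ = ∑_{N ≤ n < 2N, n ≡ v₀ (W)} (∑_{dᵢ ∣ n + hᵢ} λ_d)²` (Maynard 2015, (4.2)).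
[cite: MaynardAnnals2015, (4.2)] -/
noncomputable def S1 (D₀ Rn W N : ℕ) (v₀ : ℤ) (y : Finset (ℕ × Fin k) → ℝ) (h : Fin k → ℤ) : ℝ :=
  ∑ n ∈ sieveRange W N v₀, sieveTerm D₀ Rn y h n ^ 2

/-- The main-term double sum of Lemma 5.1 after the Chinese remainder theorem:
`Σ'₁ = ∑'_{d, e} λ_d λ_e / ∏ᵢ [dᵢ, eᵢ]` over compatible pairs (Maynard 2015, (5.2), main term).
[cite: MaynardAnnals2015, proof of Lemma 5.1, (5.2)] -/
noncomputable def mainSum1 (D₀ Rn : ℕ) (y : Finset (ℕ × Fin k) → ℝ) : ℝ :=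
  ∑ B ∈ tuplesProd k D₀ Rn, ∑ C ∈ tuplesProd k D₀ Rn,
    if IsFunctional (B ∪ C) then
      lam D₀ Rn y B * lam D₀ Rn y C / ∏ p ∈ (B ∪ C).image Prod.fst, (p : ℝ)
    else 0

/-- `φ(A) > 0`. [folklore] -/
theorem phiA_pos {A : Finset (ℕ × Fin k)} (hp : ∀ x ∈ A, x.1.Prime) : 0 < phiA A :=
  Finset.prod_pos fun x hx => by
    have : (2:ℝ) ≤ x.1 := by exact_mod_cast (hp x hx).two_le
    linarith

/-- `∏B > 0`. [folklore] -/
theorem prodA_pos {B : Finset (ℕ × Fin k)} (hp : ∀ x ∈ B, x.1.Prime) : 0 < prodA B :=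
  Finset.prod_pos fun x hx => by exact_mod_cast (hp x hx).pos

/-- `φ` is multiplicative over disjoint unions. [folklore] -/
theorem phiA_union {A B : Finset (ℕ × Fin k)} (h : Disjoint A B) : phiA (A ∪ B) = phiA A * phiA B :=
  Finset.prod_union h

end Setup

/-! ### Lemma 5.1, first step: the Chinese remainder theorem -/

section CRTStep

variable {k : ℕ} {D₀ Rn N : ℕ} {h : Fin k → ℤ} {v₀ : ℤ}

/-- Hypotheses on the shifts: distinct, with all differences at most `D₀` (so that no prime
`p > D₀` divides a difference `hᵢ − hⱼ`; Maynard takes `D₀ = log log log N → ∞`, here `D₀` is a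
parameter). [cite: MaynardAnnals2015, §4 (choice of W and v₀)] -/
structure ShiftHyp (k D₀ : ℕ) (h : Fin k → ℤ) : Prop where
  inj : Function.Injective h
  diam : ∀ i j, |h i - h j| ≤ D₀

/-- **No `n` for incompatible pairs** (Maynard 2015, proof of Lemma 5.1: "If the integers are not
pairwise coprime then the inner sum is empty"): if `B ∪ C` is not functional (a prime `p > D₀`
would divide `n + hᵢ` and `n + hⱼ` with `i ≠ j`), no integer satisfies both divisibility conditions.
[cite: MaynardAnnals2015, proof of Lemma 5.1] -/
theorem not_divides_of_not_isFunctional (hh : ShiftHyp k D₀ h) {B C : Finset (ℕ × Fin k)}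
    (hB : B ∈ tuplesProd k D₀ Rn) (hC : C ∈ tuplesProd k D₀ Rn) (hBC : ¬IsFunctional (B ∪ C))
    (n : ℤ) : ¬(Divides h B n ∧ Divides h C n) := by
  rintro ⟨hdB, hdC⟩
  have hd : ∀ x ∈ B ∪ C, ((x.1 : ℕ) : ℤ) ∣ n + h x.2 := fun x hx =>
    (Finset.mem_union.1 hx).elim (hdB x) (hdC x)
  have hmem : ∀ x ∈ B ∪ C, D₀ < x.1 ∧ x.1.Prime := fun x hx =>
    (Finset.mem_union.1 hx).elim
      (fun hx => ⟨lt_of_mem_tuples (tuplesProd_subset hB) hx, prime_of_mem_tuples (tuplesProd_subset hB) hx⟩)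
      (fun hx => ⟨lt_of_mem_tuples (tuplesProd_subset hC) hx, prime_of_mem_tuples (tuplesProd_subset hC) hx⟩)
  unfold IsFunctional at hBC
  push Not at hBC
  obtain ⟨x, hx, y, hy, hxy, hne⟩ := hBC
  have hij : x.2 ≠ y.2 := fun h2 => hne (Prod.ext hxy h2)
  have h1 := hd x hx
  have h2 := hd y hy
  rw [← hxy] at h2
  have hdiff : ((x.1 : ℕ) : ℤ) ∣ h x.2 - h y.2 := by
    have := dvd_sub h1 h2
    rwa [add_sub_add_left_eq_sub] at this
  have hne' : h x.2 - h y.2 ≠ 0 := sub_ne_zero.2 fun e => hij (hh.inj e)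
  have hle := Int.le_of_dvd (abs_pos.2 hne') ((dvd_abs _ _).2 hdiff)  -- p ≤ |h i - h j|
  have := hh.diam x.2 y.2
  have hp := (hmem x hx).1
  omega

/-- The target residues: for a prime `p` of the compatible pair `(B, C)`, `n ≡ −hᵢ (mod p)` where
`i` is the index carried by `p`. [folklore] -/
noncomputable def targetRes (h : Fin k → ℤ) (U : Finset (ℕ × Fin k)) (p : ℕ) : ℤ :=
  if hp : ∃ x ∈ U, x.1 = p then -h (Classical.choose hp).2 else 0

/-- The target residue at the prime of `x ∈ U` is `−h_{x.2}` (for functional `U`). [folklore] -/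
theorem targetRes_eq_neg {U : Finset (ℕ × Fin k)} (hU : IsFunctional U) {x : ℕ × Fin k} (hx : x ∈ U) :
    targetRes h U x.1 = -h x.2 := by
  have hp : ∃ y ∈ U, y.1 = x.1 := ⟨x, hx, rfl⟩
  rw [targetRes, dif_pos hp]
  have hspec := Classical.choose_spec hp
  rw [hU _ hspec.1 x hx hspec.2]

/-- The divisibility conditions of a compatible pair as congruences modulo its primes. [folklore] -/
theorem divides_union_iff {U : Finset (ℕ × Fin k)} (hU : IsFunctional U) (n : ℤ) :
    (∀ x ∈ U, ((x.1 : ℕ) : ℤ) ∣ n + h x.2) ↔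
      ∀ p ∈ U.image Prod.fst, n ≡ targetRes h U p [ZMOD p] := by
  have key : ∀ x ∈ U, targetRes h U x.1 = -h x.2 := fun x hx => targetRes_eq_neg hU hx
  constructor
  · intro hd p hp
    obtain ⟨x, hx, rfl⟩ := Finset.mem_image.1 hp
    rw [key x hx, Int.modEq_iff_dvd]
    have := hd x hx
    rwa [show -h x.2 - n = -(n + h x.2) by ring, dvd_neg]
  · intro hc x hx
    have := hc x.1 (Finset.mem_image.2 ⟨x, hx, rfl⟩)
    rw [key x hx, Int.modEq_iff_dvd, show -h x.2 - n = -(n + h x.2) by ring, dvd_neg] at this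
    exact this

/-- **The count of Lemma 5.1** (Maynard 2015: "In this case the inner sum is `N/q + O(1)`"): for a
compatible pair `(B, C)` of divisor tuples (primes `> D₀`, `W = D₀#`), the number of
`N ≤ n < 2N` with `n ≡ v₀ (mod W)` and `dᵢ, eᵢ ∣ n + hᵢ` is within `1` of `N / (W ∏_{p ∣ [d,e]} p)`.
[cite: MaynardAnnals2015, proof of Lemma 5.1, (5.2)] -/
theorem abs_card_filter_divides_sub_le {B C : Finset (ℕ × Fin k)}
    (hB : B ∈ tuplesProd k D₀ Rn) (hC : C ∈ tuplesProd k D₀ Rn) (hBC : IsFunctional (B ∪ C)) :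
    |(((sieveRange (primorial D₀) N v₀).filter (fun n => Divides h B n ∧ Divides h C n)).card : ℝ) -
      (N : ℝ) / ((primorial D₀ : ℝ) * ∏ p ∈ (B ∪ C).image Prod.fst, (p : ℝ))| ≤ 1 := by
  set U := (B ∪ C).image Prod.fst with hU
  have hUp : ∀ p ∈ U, p.Prime := fun p hp => by
    obtain ⟨x, hx, rfl⟩ := Finset.mem_image.1 hp
    exact (Finset.mem_union.1 hx).elim (fun hx => prime_of_mem_tuples (tuplesProd_subset hB) hx)
      (fun hx => prime_of_mem_tuples (tuplesProd_subset hC) hx)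
  have hUW : ∀ p ∈ U, ¬p ∣ primorial D₀ := fun p hp => by
    obtain ⟨x, hx, rfl⟩ := Finset.mem_image.1 hp
    have hlt : D₀ < x.1 := (Finset.mem_union.1 hx).elim (fun hx => lt_of_mem_tuples (tuplesProd_subset hB) hx)
      (fun hx => lt_of_mem_tuples (tuplesProd_subset hC) hx)
    rw [(hUp x.1 hp).dvd_primorial_iff]
    omega
  obtain ⟨a, ha⟩ := exists_forall_modEq_iff (primorial D₀) U hUp hUW (targetRes h (B ∪ C)) v₀
  -- the filtered range is a residue class modulo `W ∏ U`
  have hset : (sieveRange (primorial D₀) N v₀).filter (fun n => Divides h B n ∧ Divides h C n) =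
      (Finset.Ico (N : ℤ) (2 * N)).filter (fun n => n ≡ a [ZMOD ((primorial D₀ * ∏ p ∈ U, p : ℕ) : ℤ)]) := by
    ext n
    simp only [sieveRange, Finset.mem_filter, and_assoc]
    rw [← ha n, ← divides_union_iff hBC n]
    constructor
    · rintro ⟨h1, h2, h3, h4⟩
      exact ⟨h1, h2, fun x hx => (Finset.mem_union.1 hx).elim (h3 x) (h4 x)⟩
    · rintro ⟨h1, h2, h3⟩
      exact ⟨h1, h2, fun x hx => h3 x (Finset.mem_union_left _ hx),
        fun x hx => h3 x (Finset.mem_union_right _ hx)⟩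
  rw [hset]
  have hr : (0 : ℤ) < ((primorial D₀ * ∏ p ∈ U, p : ℕ) : ℤ) := by
    have : 0 < primorial D₀ * ∏ p ∈ U, p :=
      Nat.mul_pos (primorial_pos D₀) (Finset.prod_pos fun p hp => (hUp p hp).pos)
    exact_mod_cast this
  have key := abs_card_filter_modEq_sub_le (N : ℤ) (2 * N) a (by omega) hr
  have e : (((2 * (N : ℤ) : ℤ) : ℝ) - ((N : ℤ) : ℝ)) / (((primorial D₀ * ∏ p ∈ U, p : ℕ) : ℤ) : ℝ) =
      (N : ℝ) / ((primorial D₀ : ℝ) * ∏ p ∈ U, (p : ℝ)) := by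
    push_cast; ring
  rw [e] at key
  exact key

/-- **Lemma 5.1, first step** (Maynard 2015, (5.2)): `S₁ = (N/W) Σ'₁ + O((∑_d |λ_d|)²)`, in the
explicit form `|S₁ − (N/W) Σ'₁| ≤ (∑_d |λ_d|)²`. [cite: MaynardAnnals2015, Lemma 5.1, (5.2)] -/
theorem abs_S1_sub_mainSum1_le (hh : ShiftHyp k D₀ h) (y : Finset (ℕ × Fin k) → ℝ) :
    |S1 D₀ Rn (primorial D₀) N v₀ y h - (N : ℝ) / primorial D₀ * mainSum1 D₀ Rn y| ≤
      (∑ B ∈ tuplesProd k D₀ Rn, |lam D₀ Rn y B|) ^ 2 := by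
  set T := tuplesProd k D₀ Rn with hT
  set W := primorial D₀ with hW
  set rng := sieveRange W N v₀
  -- expand the square and bring the sum over `n` inside
  have hexp : S1 D₀ Rn W N v₀ y h = ∑ B ∈ T, ∑ C ∈ T, lam D₀ Rn y B * lam D₀ Rn y C *
      ((rng.filter (fun n => Divides h B n ∧ Divides h C n)).card : ℝ) := by
    unfold S1 sieveTerm
    simp_rw [sq, Finset.sum_mul_sum, ← hT]
    rw [Finset.sum_comm]
    refine Finset.sum_congr rfl fun B _ => ?_
    rw [Finset.sum_comm]
    refine Finset.sum_congr rfl fun C _ => ?_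
    rw [Finset.card_eq_sum_ones, Nat.cast_sum, Finset.mul_sum, Finset.sum_filter]
    refine Finset.sum_congr rfl fun n _ => ?_
    by_cases h1 : Divides h B n <;> by_cases h2 : Divides h C n <;> simp [h1, h2]
  -- the main sum with the exact counts replaced by `N/(W q)`
  have hmain : (N : ℝ) / W * mainSum1 D₀ Rn y = ∑ B ∈ T, ∑ C ∈ T,
      if IsFunctional (B ∪ C) then lam D₀ Rn y B * lam D₀ Rn y C *
        ((N : ℝ) / (W * ∏ p ∈ (B ∪ C).image Prod.fst, (p : ℝ))) else 0 := by
    unfold mainSum1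
    rw [← hT, Finset.mul_sum]
    refine Finset.sum_congr rfl fun B _ => ?_
    rw [Finset.mul_sum]
    refine Finset.sum_congr rfl fun C _ => ?_
    split_ifs
    · ring
    · rw [mul_zero]
  rw [hexp, hmain, ← Finset.sum_sub_distrib]
  simp_rw [← Finset.sum_sub_distrib]
  -- termwise bound
  calc |∑ B ∈ T, ∑ C ∈ T, (lam D₀ Rn y B * lam D₀ Rn y C *
          ((rng.filter (fun n => Divides h B n ∧ Divides h C n)).card : ℝ) -
          (if IsFunctional (B ∪ C) then lam D₀ Rn y B * lam D₀ Rn y C *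
            ((N : ℝ) / (W * ∏ p ∈ (B ∪ C).image Prod.fst, (p : ℝ))) else 0))|
      ≤ ∑ B ∈ T, ∑ C ∈ T, |lam D₀ Rn y B| * |lam D₀ Rn y C| := by
        refine (Finset.abs_sum_le_sum_abs _ _).trans (Finset.sum_le_sum fun B hB => ?_)
        refine (Finset.abs_sum_le_sum_abs _ _).trans (Finset.sum_le_sum fun C hC => ?_)
        by_cases hf : IsFunctional (B ∪ C)
        · rw [if_pos hf, ← mul_sub, abs_mul, abs_mul]
          refine mul_le_of_le_one_right (by positivity) ?_
          exact abs_card_filter_divides_sub_le hB hC hf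
        · rw [if_neg hf, sub_zero]
          have h0 : (rng.filter (fun n => Divides h B n ∧ Divides h C n)).card = 0 := by
            rw [Finset.card_eq_zero, Finset.filter_eq_empty_iff]
            exact fun n _ => not_divides_of_not_isFunctional hh hB hC hf n
          rw [h0, Nat.cast_zero, mul_zero, abs_zero]
          positivity
    _ = (∑ B ∈ T, |lam D₀ Rn y B|) ^ 2 := by
        rw [sq, Finset.sum_mul_sum]

end CRTStep


/-! ### Lemma 5.1, second step: the quadratic form in `y` and its diagonal -/

section Diagonal

variable {k : ℕ} {D₀ Rn : ℕ}

/-- Exchanging "divisor tuple first" and "support tuple first". [folklore] -/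
theorem sum_tuplesProd_sum_superset (F : Finset (ℕ × Fin k) → Finset (ℕ × Fin k) → ℝ) :
    ∑ B ∈ tuplesProd k D₀ Rn, ∑ A ∈ (tuplesProd k D₀ Rn).filter (fun A => B ⊆ A), F B A =
      ∑ A ∈ tuplesProd k D₀ Rn, ∑ B ∈ A.powerset, F B A := by
  refine Finset.sum_comm' fun B A => ?_
  rw [Finset.mem_filter, Finset.mem_powerset]
  constructor
  · rintro ⟨-, hA, hBA⟩; exact ⟨hBA, hA⟩
  · rintro ⟨hBA, hA⟩; exact ⟨subset_mem_tuplesProd hA hBA, hA, hBA⟩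

/-- **The quadratic form** (Maynard 2015, substitution of (5.8) into (5.6)): with the kernel of
`MaynardSieveKernel`, `Σ'₁ = ∑_{A, A'} y_A y_{A'} K(A, A') / (φ(A) φ(A'))`.
[cite: MaynardAnnals2015, proof of Lemma 5.1, (5.6)–(5.8)] -/
theorem mainSum1_eq_sum_kernel (y : Finset (ℕ × Fin k) → ℝ) :
    mainSum1 D₀ Rn y = ∑ A ∈ tuplesProd k D₀ Rn, ∑ A' ∈ tuplesProd k D₀ Rn,
      y A * y A' / (phiA A * phiA A') * kernel (fun p => (p : ℝ)) A A' := by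
  set T := tuplesProd k D₀ Rn with hT
  -- Step 1: expand `λ_B λ_C` as a double sum over `A ⊇ B`, `A' ⊇ C`
  have step1 : mainSum1 D₀ Rn y = ∑ B ∈ T, ∑ C ∈ T, ∑ A ∈ T.filter (fun A => B ⊆ A),
      ∑ A' ∈ T.filter (fun A' => C ⊆ A'),
        (if IsFunctional (B ∪ C) then
          (-1 : ℝ) ^ B.card * (-1 : ℝ) ^ C.card * (prodA B * prodA C) /
            ∏ p ∈ (B ∪ C).image Prod.fst, (p : ℝ) else 0) * (y A / phiA A * (y A' / phiA A')) := by
    unfold mainSum1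
    rw [← hT]
    refine Finset.sum_congr rfl fun B _ => Finset.sum_congr rfl fun C _ => ?_
    split_ifs with hf
    · unfold lam
      rw [← hT]
      simp_rw [← Finset.mul_sum]
      rw [← Finset.sum_mul]
      ring
    · simp
  -- Step 2: exchange the order of summation
  have step2 : ∑ B ∈ T, ∑ C ∈ T, ∑ A ∈ T.filter (fun A => B ⊆ A),
      ∑ A' ∈ T.filter (fun A' => C ⊆ A'),
        (if IsFunctional (B ∪ C) then
          (-1 : ℝ) ^ B.card * (-1 : ℝ) ^ C.card * (prodA B * prodA C) /
            ∏ p ∈ (B ∪ C).image Prod.fst, (p : ℝ) else 0) * (y A / phiA A * (y A' / phiA A')) =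
      ∑ A ∈ T, ∑ A' ∈ T, ∑ B ∈ A.powerset, ∑ C ∈ A'.powerset,
        (if IsFunctional (B ∪ C) then
          (-1 : ℝ) ^ B.card * (-1 : ℝ) ^ C.card * (prodA B * prodA C) /
            ∏ p ∈ (B ∪ C).image Prod.fst, (p : ℝ) else 0) * (y A / phiA A * (y A' / phiA A')) := by
    -- move `A` outside `C`, then swap `(B, A)` and `(C, A')`
    have e1 : ∀ B ∈ T, ∑ C ∈ T, ∑ A ∈ T.filter (fun A => B ⊆ A),
        ∑ A' ∈ T.filter (fun A' => C ⊆ A'),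
          (if IsFunctional (B ∪ C) then
            (-1 : ℝ) ^ B.card * (-1 : ℝ) ^ C.card * (prodA B * prodA C) /
              ∏ p ∈ (B ∪ C).image Prod.fst, (p : ℝ) else 0) * (y A / phiA A * (y A' / phiA A')) =
        ∑ A ∈ T.filter (fun A => B ⊆ A), ∑ A' ∈ T, ∑ C ∈ A'.powerset,
          (if IsFunctional (B ∪ C) then
            (-1 : ℝ) ^ B.card * (-1 : ℝ) ^ C.card * (prodA B * prodA C) /
              ∏ p ∈ (B ∪ C).image Prod.fst, (p : ℝ) else 0) * (y A / phiA A * (y A' / phiA A')) := by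
      intro B _
      rw [Finset.sum_comm]
      refine Finset.sum_congr rfl fun A _ => ?_
      exact sum_tuplesProd_sum_superset _
    rw [Finset.sum_congr rfl e1, hT, sum_tuplesProd_sum_superset]
    refine Finset.sum_congr rfl fun A _ => ?_
    rw [Finset.sum_comm]
  -- Step 3: recognise the kernel
  rw [step1, step2]
  refine Finset.sum_congr rfl fun A _ => Finset.sum_congr rfl fun A' _ => ?_
  rw [kernel, Finset.mul_sum]
  refine Finset.sum_congr rfl fun B _ => ?_
  rw [Finset.mul_sum]
  refine Finset.sum_congr rfl fun C _ => ?_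
  unfold prodA
  split_ifs <;> ring

/-- `φ(A)` as a product over the primes of `A`. [folklore] -/
theorem phiA_eq_prod_image {A : Finset (ℕ × Fin k)} (hA : IsFunctional A) :
    phiA A = ∏ p ∈ A.image Prod.fst, ((p : ℝ) - 1) :=
  prod_eq_prod_image_fst hA fun p => (p : ℝ) - 1

/-- **The kernel for `S₁`** (`d(p) = p`): zero unless `A, A'` have the same primes, and then
`∏_p (p − 1 if the indices agree, −1 otherwise)`. [cite: MaynardAnnals2015, proof of Lemma 5.1, (5.6)] -/
theorem kernel_id_eq {A A' : Finset (ℕ × Fin k)} (hA : A ∈ tuplesProd k D₀ Rn)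
    (hA' : A' ∈ tuplesProd k D₀ Rn) :
    kernel (fun p => (p : ℝ)) A A' =
      if A.image Prod.fst = A'.image Prod.fst then
        ∏ p ∈ A.image Prod.fst, (if p ∈ (A ∩ A').image Prod.fst then ((p : ℝ) - 1) else -1)
      else 0 := by
  have hfA := isFunctional_of_mem_tuples (tuplesProd_subset hA)
  have hfA' := isFunctional_of_mem_tuples (tuplesProd_subset hA')
  have hpV : ∀ p ∈ (A ∪ A').image Prod.fst, (p : ℝ) ≠ 0 := fun p hp => by
    obtain ⟨x, hx, rfl⟩ := Finset.mem_image.1 hp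
    have : x.1.Prime := (Finset.mem_union.1 hx).elim (fun h => prime_of_mem_tuples (tuplesProd_subset hA) h)
      (fun h => prime_of_mem_tuples (tuplesProd_subset hA') h)
    exact_mod_cast this.ne_zero
  have hSsub : ∀ p, p ∈ (A ∩ A').image Prod.fst → p ∈ A.image Prod.fst ∧ p ∈ A'.image Prod.fst := by
    intro p h
    obtain ⟨x, hx, rfl⟩ := Finset.mem_image.1 h
    rw [Finset.mem_inter] at hx
    exact ⟨Finset.mem_image.2 ⟨x, hx.1, rfl⟩, Finset.mem_image.2 ⟨x, hx.2, rfl⟩⟩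
  rw [kernel_eq_prod_kernelLoc hfA hfA']
  split_ifs with heq
  · rw [Finset.image_union, ← heq, Finset.union_idempotent]
    refine Finset.prod_congr rfl fun p hp => ?_
    have hp' : p ∈ A'.image Prod.fst := heq ▸ hp
    have hp0 : (p : ℝ) ≠ 0 := hpV p (by rw [Finset.image_union]; exact Finset.mem_union_left _ hp)
    unfold kernelLoc
    rw [if_pos hp, if_pos hp']
    split_ifs <;> field_simp <;> ring
  · -- a prime in exactly one of the two tuples kills the product
    have : ∃ p ∈ (A ∪ A').image Prod.fst, ¬(p ∈ A.image Prod.fst ∧ p ∈ A'.image Prod.fst) := by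
      by_contra hall
      push Not at hall
      apply heq
      ext p
      constructor
      · intro hp
        exact (hall p (by rw [Finset.image_union]; exact Finset.mem_union_left _ hp)).2
      · intro hp
        exact (hall p (by rw [Finset.image_union]; exact Finset.mem_union_right _ hp)).1
    obtain ⟨p, hpV', hnot⟩ := this
    refine Finset.prod_eq_zero hpV' ?_
    have hp0 : (p : ℝ) ≠ 0 := hpV p hpV'
    have hS : p ∉ (A ∩ A').image Prod.fst := fun h => hnot (hSsub p h)
    unfold kernelLoc
    rw [if_neg hS]
    rw [Finset.image_union, Finset.mem_union] at hpV'
    by_cases h1 : p ∈ A.image Prod.fst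
    · have h2 : p ∉ A'.image Prod.fst := fun h2 => hnot ⟨h1, h2⟩
      rw [if_pos h1, if_neg h2]; field_simp; ring
    · have h2 : p ∈ A'.image Prod.fst := hpV'.resolve_left h1
      rw [if_neg h1, if_pos h2]; field_simp; ring

/-- The diagonal value `K(A, A) = φ(A)`. [cite: MaynardAnnals2015, (5.7)] -/
theorem kernel_id_self {A : Finset (ℕ × Fin k)} (hA : A ∈ tuplesProd k D₀ Rn) :
    kernel (fun p => (p : ℝ)) A A = phiA A := by
  rw [kernel_id_eq hA hA, if_pos rfl, Finset.inter_self,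
    phiA_eq_prod_image (isFunctional_of_mem_tuples (tuplesProd_subset hA))]
  exact Finset.prod_congr rfl fun p hp => if_pos hp

end Diagonal


/-! ### Lemma 5.1, third step: the off-diagonal terms (Maynard's `s_{i,j} > D₀`) -/

section OffDiagonal

variable {k : ℕ} {D₀ Rn : ℕ}

/-- The index carried by the prime `p` in `A` (junk `0` if none). [folklore] -/
noncomputable def idxOf [NeZero k] (A : Finset (ℕ × Fin k)) (p : ℕ) : Fin k :=
  if h : ∃ x ∈ A, x.1 = p then (Classical.choose h).2 else 0

/-- The pair of `A` at a prime of `A`. [folklore] -/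
theorem pair_idxOf_mem [NeZero k] {A : Finset (ℕ × Fin k)} {p : ℕ} (hp : p ∈ A.image Prod.fst) :
    (p, idxOf A p) ∈ A := by
  obtain ⟨x, hx, rfl⟩ := Finset.mem_image.1 hp
  have h : ∃ y ∈ A, y.1 = x.1 := ⟨x, hx, rfl⟩
  rw [idxOf, dif_pos h]
  obtain ⟨hmem, heq⟩ := Classical.choose_spec h
  have : (x.1, (Classical.choose h).2) = Classical.choose h := Prod.ext heq.symm rfl
  rw [this]; exact hmem

/-- Pairs of support tuples with the same set of primes (the only pairs with `K ≠ 0`). [folklore] -/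
noncomputable def eqPairs (k D₀ Rn : ℕ) : Finset (Finset (ℕ × Fin k) × Finset (ℕ × Fin k)) :=
  (tuplesProd k D₀ Rn ×ˢ tuplesProd k D₀ Rn).filter (fun P => P.1.image Prod.fst = P.2.image Prod.fst)

/-- Membership in `eqPairs`. [folklore] -/
theorem mem_eqPairs {P : Finset (ℕ × Fin k) × Finset (ℕ × Fin k)} :
    P ∈ eqPairs k D₀ Rn ↔ P.1 ∈ tuplesProd k D₀ Rn ∧ P.2 ∈ tuplesProd k D₀ Rn ∧
      P.1.image Prod.fst = P.2.image Prod.fst := by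
  rw [eqPairs, Finset.mem_filter, Finset.mem_product, and_assoc]

/-- The off-diagonal weight `|K(A, A')| / (φ(A) φ(A')) = ∏_{p, same index} 1/(p−1) ·
∏_{p, different index} 1/(p−1)²` (cf. Maynard (5.13): the factors `μ(s)²/φ(s)²`).
[cite: MaynardAnnals2015, proof of Lemma 5.1, (5.13)–(5.14)] -/
noncomputable def offW (P : Finset (ℕ × Fin k) × Finset (ℕ × Fin k)) : ℝ :=
  ∏ p ∈ P.1.image Prod.fst,
    if p ∈ (P.1 ∩ P.2).image Prod.fst then 1 / ((p : ℝ) - 1) else 1 / ((p : ℝ) - 1) ^ 2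

/-- `offW ≥ 0`. [folklore] -/
theorem offW_nonneg {P : Finset (ℕ × Fin k) × Finset (ℕ × Fin k)} (hP : P ∈ eqPairs k D₀ Rn) :
    0 ≤ offW P := by
  refine Finset.prod_nonneg fun p hp => ?_
  obtain ⟨x, hx, rfl⟩ := Finset.mem_image.1 hp
  have h2 : (2:ℝ) ≤ x.1 := by
    exact_mod_cast (prime_of_mem_tuples (tuplesProd_subset (mem_eqPairs.1 hP).1) hx).two_le
  have : 0 < (x.1 : ℝ) - 1 := by linarith
  split_ifs <;> positivity

/-- The mismatched primes of a pair: primes carrying different indices in `A` and `A'`. [folklore] -/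
noncomputable def mism (P : Finset (ℕ × Fin k) × Finset (ℕ × Fin k)) : Finset ℕ :=
  P.1.image Prod.fst \ (P.1 ∩ P.2).image Prod.fst

/-- The least mismatched prime (junk `0` if none). [folklore] -/
noncomputable def minMism (P : Finset (ℕ × Fin k) × Finset (ℕ × Fin k)) : ℕ :=
  if h : (mism P).Nonempty then (mism P).min' h else 0

/-- A pair `A ≠ A'` with the same primes has a mismatched prime. [folklore] -/
theorem mism_nonempty {P : Finset (ℕ × Fin k) × Finset (ℕ × Fin k)} (hP : P ∈ eqPairs k D₀ Rn)
    (hne : P.1 ≠ P.2) : (mism P).Nonempty := by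
  rw [mem_eqPairs] at hP
  obtain ⟨h1, h2, heq⟩ := hP
  have hf1 := isFunctional_of_mem_tuples (tuplesProd_subset h1)
  have hf2 := isFunctional_of_mem_tuples (tuplesProd_subset h2)
  by_contra hem
  rw [Finset.not_nonempty_iff_eq_empty, mism, Finset.sdiff_eq_empty_iff_subset] at hem
  -- every prime of `A` (= of `A'`) carries the same index: `A = A'`
  have key : ∀ (A A' : Finset (ℕ × Fin k)), IsFunctional A →
      A.image Prod.fst ⊆ (A ∩ A').image Prod.fst → A ⊆ A' := by
    intro A A' hA hsub x hx
    obtain ⟨z, hz, hzx⟩ := Finset.mem_image.1 (hsub (Finset.mem_image.2 ⟨x, hx, rfl⟩))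
    rw [Finset.mem_inter] at hz
    rw [← hA z hz.1 x hx hzx]; exact hz.2
  apply hne
  refine Finset.Subset.antisymm (key P.1 P.2 hf1 hem) (key P.2 P.1 hf2 ?_)
  rw [Finset.inter_comm, ← heq]; exact hem

/-- The least mismatched prime is mismatched. [folklore] -/
theorem minMism_mem {P : Finset (ℕ × Fin k) × Finset (ℕ × Fin k)} (hP : P ∈ eqPairs k D₀ Rn)
    (hne : P.1 ≠ P.2) : minMism P ∈ mism P := by
  rw [minMism, dif_pos (mism_nonempty hP hne)]; exact Finset.min'_mem _ _

/-- The peeling key: the least mismatched prime with its two indices. [folklore] -/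
noncomputable def peelKey [NeZero k] (P : Finset (ℕ × Fin k) × Finset (ℕ × Fin k)) : ℕ × Fin k × Fin k :=
  (minMism P, idxOf P.1 (minMism P), idxOf P.2 (minMism P))

/-- Peeling: remove the least mismatched prime from both tuples. [folklore] -/
noncomputable def peelPair [NeZero k] (P : Finset (ℕ × Fin k) × Finset (ℕ × Fin k)) :
    Finset (ℕ × Fin k) × Finset (ℕ × Fin k) :=
  (P.1.erase (minMism P, idxOf P.1 (minMism P)), P.2.erase (minMism P, idxOf P.2 (minMism P)))

/-- Erasing the pair at `p₀` removes exactly the prime `p₀`. [folklore] -/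
theorem image_fst_erase {A : Finset (ℕ × Fin k)} (hA : IsFunctional A) {x₀ : ℕ × Fin k} (hx₀ : x₀ ∈ A) :
    (A.erase x₀).image Prod.fst = (A.image Prod.fst).erase x₀.1 := by
  ext p
  simp only [Finset.mem_image, Finset.mem_erase]
  constructor
  · rintro ⟨x, ⟨hne, hx⟩, rfl⟩
    exact ⟨fun h => hne (hA x hx x₀ hx₀ h), x, hx, rfl⟩
  · rintro ⟨hne, x, hx, rfl⟩
    exact ⟨x, ⟨fun h => hne (by rw [h]), hx⟩, rfl⟩

section peel

variable {P : Finset (ℕ × Fin k) × Finset (ℕ × Fin k)}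
  (hP : P ∈ eqPairs k D₀ Rn) (hne : P.1 ≠ P.2)
include hP hne

/-- The least mismatched prime is a prime of `A`. [folklore] -/
theorem minMism_mem_image_fst : minMism P ∈ P.1.image Prod.fst :=
  (Finset.mem_sdiff.1 (minMism_mem hP hne)).1

/-- The least mismatched prime is a prime of `A'`. [folklore] -/
theorem minMism_mem_image_snd : minMism P ∈ P.2.image Prod.fst := by
  rw [← (mem_eqPairs.1 hP).2.2]; exact minMism_mem_image_fst hP hne

/-- The least mismatched prime carries different indices. [folklore] -/
theorem minMism_not_mem_inter : minMism P ∉ (P.1 ∩ P.2).image Prod.fst :=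
  (Finset.mem_sdiff.1 (minMism_mem hP hne)).2

/-- The pair of `A` at the least mismatched prime. [folklore] -/
theorem fstPair_mem [NeZero k] : (minMism P, idxOf P.1 (minMism P)) ∈ P.1 :=
  pair_idxOf_mem (minMism_mem_image_fst hP hne)

/-- The pair of `A'` at the least mismatched prime. [folklore] -/
theorem sndPair_mem [NeZero k] : (minMism P, idxOf P.2 (minMism P)) ∈ P.2 :=
  pair_idxOf_mem (minMism_mem_image_snd hP hne)

/-- The intersection is untouched by peeling. [folklore] -/
theorem peelPair_inter [NeZero k] : (peelPair P).1 ∩ (peelPair P).2 = P.1 ∩ P.2 := by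
  ext z
  simp only [peelPair, Finset.mem_inter, Finset.mem_erase]
  constructor
  · rintro ⟨⟨-, h1⟩, -, h2⟩; exact ⟨h1, h2⟩
  · rintro ⟨h1, h2⟩
    have hz : z.1 ≠ minMism P := fun h => minMism_not_mem_inter hP hne
      (Finset.mem_image.2 ⟨z, Finset.mem_inter.2 ⟨h1, h2⟩, h⟩)
    exact ⟨⟨fun h => hz (by rw [h]), h1⟩, fun h => hz (by rw [h]), h2⟩

/-- Peeling stays within `eqPairs`. [folklore] -/
theorem peelPair_mem [NeZero k] : peelPair P ∈ eqPairs k D₀ Rn := by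
  obtain ⟨h1, h2, heq⟩ := mem_eqPairs.1 hP
  rw [mem_eqPairs]
  refine ⟨subset_mem_tuplesProd h1 (Finset.erase_subset _ _),
    subset_mem_tuplesProd h2 (Finset.erase_subset _ _), ?_⟩
  simp only [peelPair]
  rw [image_fst_erase (isFunctional_of_mem_tuples (tuplesProd_subset h1)) (fstPair_mem hP hne),
    image_fst_erase (isFunctional_of_mem_tuples (tuplesProd_subset h2)) (sndPair_mem hP hne), heq]

/-- Peeling removes the factor `1/(p₀ − 1)²`. [folklore] -/
theorem offW_eq_mul_offW_peelPair [NeZero k] :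
    offW P = 1 / ((minMism P : ℝ) - 1) ^ 2 * offW (peelPair P) := by
  obtain ⟨h1, h2, heq⟩ := mem_eqPairs.1 hP
  have hf1 := isFunctional_of_mem_tuples (tuplesProd_subset h1)
  unfold offW
  rw [peelPair_inter hP hne, ← Finset.mul_prod_erase _ _ (minMism_mem_image_fst hP hne),
    if_neg (minMism_not_mem_inter hP hne)]
  congr 1
  simp only [peelPair]
  rw [image_fst_erase hf1 (fstPair_mem hP hne)]

/-- The peeling key lies in `primes × indices × indices`. [folklore] -/
theorem peelKey_mem [NeZero k] : peelKey P ∈ primesIoc D₀ Rn ×ˢ (Finset.univ : Finset (Fin k)) ×ˢ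
    (Finset.univ : Finset (Fin k)) := by
  simp only [peelKey, Finset.mem_product, Finset.mem_univ, and_true]
  obtain ⟨x, hx, hx1⟩ := Finset.mem_image.1 (minMism_mem_image_fst hP hne)
  rw [← hx1]
  exact (mem_tuples.1 (tuplesProd_subset (mem_eqPairs.1 hP).1)).1 x hx

end peel

/-- **The off-diagonal bound for `S₁`** (Maynard 2015, (5.13)–(5.14): the terms with some
`s_{i,j} > D₀` contribute `O(1/D₀)` of the main term; here by peeling the least mismatched prime):
for `D₀ ≥ 8k²`,
`∑_{(A, A') off-diagonal} |K(A,A')|/(φ(A)φ(A')) ≤ (8k²/D₀) ∑_A 1/φ(A)`.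
[cite: MaynardAnnals2015, proof of Lemma 5.1, (5.14)] -/
theorem sum_offW_le [NeZero k] (hD : 8 * k ^ 2 ≤ D₀) :
    ∑ P ∈ (eqPairs k D₀ Rn).filter (fun P => P.1 ≠ P.2), offW P ≤
      8 * (k : ℝ) ^ 2 / D₀ * ∑ A ∈ tuplesProd k D₀ Rn, 1 / phiA A := by
  have hk : 0 < k := Nat.pos_of_ne_zero (NeZero.ne k)
  have hD0 : 0 < D₀ := lt_of_lt_of_le (by positivity) hD
  set Kset := primesIoc D₀ Rn ×ˢ (Finset.univ : Finset (Fin k)) ×ˢ (Finset.univ : Finset (Fin k))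
  set c : ℕ × Fin k × Fin k → ℝ := fun κ => 1 / ((κ.1 : ℝ) - 1) ^ 2 with hc
  -- the peeling inequality
  have hpeel := sum_filter_le_of_peel (eqPairs k D₀ Rn) (fun P => P.1 ≠ P.2) offW
    (fun P hP => offW_nonneg hP) Kset c (fun κ _ => by positivity) peelKey peelPair
    (fun P hP hne => peelKey_mem hP hne) (fun P hP hne => peelPair_mem hP hne)
    (fun P hP hne => by rw [offW_eq_mul_offW_peelPair hP hne]; exact le_rfl)
    (by
      rintro ⟨p₀, i, j⟩ _ P ⟨hP, hne, hPk⟩ Q ⟨hQ, hQne, hQk⟩ hPQ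
      simp only [peelKey, Prod.mk.injEq] at hPk hQk
      obtain ⟨hp, hi, hj⟩ := hPk
      obtain ⟨hq, hi', hj'⟩ := hQk
      have e1 := congrArg Prod.fst hPQ
      have e2 := congrArg Prod.snd hPQ
      simp only [peelPair] at e1 e2
      have m1 := fstPair_mem hP hne
      have m2 := fstPair_mem hQ hQne
      have m3 := sndPair_mem hP hne
      have m4 := sndPair_mem hQ hQne
      rw [hi, hp] at e1 m1
      rw [hi', hq] at e1 m2
      rw [hj, hp] at e2 m3
      rw [hj', hq] at e2 m4
      exact Prod.ext (by rw [← Finset.insert_erase m1, e1, Finset.insert_erase m2])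
        (by rw [← Finset.insert_erase m3, e2, Finset.insert_erase m4]))
  -- the sum of the local constants is at most `4k²/D₀ ≤ 1/2`
  have hcsum : ∑ κ ∈ Kset, c κ ≤ 4 * (k : ℝ) ^ 2 / D₀ := by
    rw [Finset.sum_product]
    have inner : ∀ p ∈ primesIoc D₀ Rn,
        ∑ ij ∈ (Finset.univ : Finset (Fin k)) ×ˢ (Finset.univ : Finset (Fin k)), c (p, ij) =
          (k : ℝ) ^ 2 * (1 / ((p : ℝ) - 1) ^ 2) := by
      intro p _
      simp only [hc, Finset.sum_const, Finset.card_product, Finset.card_univ, Fintype.card_fin,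
        nsmul_eq_mul]
      push_cast; ring
    rw [Finset.sum_congr rfl inner, ← Finset.mul_sum]
    have hp : ∑ p ∈ primesIoc D₀ Rn, 1 / ((p : ℝ) - 1) ^ 2 ≤ 4 / (D₀ : ℝ) := by
      calc ∑ p ∈ primesIoc D₀ Rn, 1 / ((p : ℝ) - 1) ^ 2
          ≤ ∑ p ∈ primesIoc D₀ Rn, 4 * (1 / (p : ℝ) ^ 2) := by
            refine Finset.sum_le_sum fun p hp => ?_
            have h2 : (2 : ℝ) ≤ p := by exact_mod_cast (mem_primesIoc.1 hp).2.two_le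
            have hp0 : (0 : ℝ) < p := by linarith
            rw [div_le_iff₀ (by nlinarith), mul_one_div, div_mul_eq_mul_div, le_div_iff₀ (by positivity)]
            nlinarith
        _ ≤ ∑ n ∈ Finset.Ioc D₀ Rn, 4 * (1 / (n : ℝ) ^ 2) :=
            Finset.sum_le_sum_of_subset_of_nonneg (Finset.filter_subset _ _) fun n _ _ => by positivity
        _ = 4 * ∑ n ∈ Finset.Ioc D₀ Rn, 1 / (n : ℝ) ^ 2 := by rw [Finset.mul_sum]
        _ ≤ 4 * (1 / (D₀ : ℝ)) := by gcongr; exact sum_Ioc_one_div_sq_le hD0 Rn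
        _ = 4 / (D₀ : ℝ) := by ring
    calc (k : ℝ) ^ 2 * ∑ p ∈ primesIoc D₀ Rn, 1 / ((p : ℝ) - 1) ^ 2 ≤ (k : ℝ) ^ 2 * (4 / (D₀ : ℝ)) := by
          gcongr
      _ = 4 * (k : ℝ) ^ 2 / D₀ := by ring
  have hs : 4 * (k : ℝ) ^ 2 / D₀ ≤ 1 / 2 := by
    rw [div_le_iff₀ (by exact_mod_cast hD0)]
    have : (8 * k ^ 2 : ℕ) ≤ (D₀ : ℝ) := by exact_mod_cast hD
    push_cast at this
    linarith
  have htot : 0 ≤ ∑ P ∈ eqPairs k D₀ Rn, offW P := Finset.sum_nonneg fun P hP => offW_nonneg hP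
  have h1 : ∑ P ∈ (eqPairs k D₀ Rn).filter (fun P => P.1 ≠ P.2), offW P ≤
      4 * (k : ℝ) ^ 2 / D₀ * ∑ P ∈ eqPairs k D₀ Rn, offW P :=
    hpeel.trans (mul_le_mul_of_nonneg_right hcsum htot)
  have h2 := sum_filter_le_of_peel_of_le_half (eqPairs k D₀ Rn) (fun P => P.1 ≠ P.2) offW
    (fun P hP => offW_nonneg hP) hs h1
  -- the good part is the diagonal `∑_A 1/φ(A)`
  have hdiag : ∑ P ∈ (eqPairs k D₀ Rn).filter (fun P => ¬P.1 ≠ P.2), offW P =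
      ∑ A ∈ tuplesProd k D₀ Rn, 1 / phiA A := by
    refine Finset.sum_nbij' (fun P => P.1) (fun A => (A, A)) ?_ ?_ ?_ ?_ ?_
    · intro P hP
      exact (mem_eqPairs.1 (Finset.mem_filter.1 hP).1).1
    · intro A hA
      exact Finset.mem_filter.2 ⟨mem_eqPairs.2 ⟨hA, hA, rfl⟩, by simp⟩
    · intro P hP
      have := (Finset.mem_filter.1 hP).2
      push Not at this
      exact Prod.ext rfl this
    · intro A _; rfl
    · intro P hP
      obtain ⟨hP', heq⟩ := Finset.mem_filter.1 hP
      push Not at heq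
      have hA := (mem_eqPairs.1 hP').1
      unfold offW
      rw [← heq, Finset.inter_self, phiA_eq_prod_image (isFunctional_of_mem_tuples (tuplesProd_subset hA)),
        one_div, ← Finset.prod_inv_distrib]
      exact Finset.prod_congr rfl fun p hp => by rw [if_pos hp, one_div]
  rw [hdiag] at h2
  calc _ ≤ 2 * (4 * (k : ℝ) ^ 2 / D₀) * ∑ A ∈ tuplesProd k D₀ Rn, 1 / phiA A := h2
    _ = 8 * (k : ℝ) ^ 2 / D₀ * ∑ A ∈ tuplesProd k D₀ Rn, 1 / phiA A := by ring

end OffDiagonal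


/-! ### Lemma 5.1, conclusion -/

section Conclusion

variable {k : ℕ} {D₀ Rn N : ℕ} {h : Fin k → ℤ} {v₀ : ℤ}

/-- `|K(A,A')| / (φ(A) φ(A')) = offW (A, A')` for pairs with the same primes. [folklore] -/
theorem abs_kernel_div_eq_offW {P : Finset (ℕ × Fin k) × Finset (ℕ × Fin k)}
    (hP : P ∈ eqPairs k D₀ Rn) :
    |kernel (fun p => (p : ℝ)) P.1 P.2| / (phiA P.1 * phiA P.2) = offW P := by
  obtain ⟨h1, h2, heq⟩ := mem_eqPairs.1 hP
  have hf1 := isFunctional_of_mem_tuples (tuplesProd_subset h1)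
  have hf2 := isFunctional_of_mem_tuples (tuplesProd_subset h2)
  rw [kernel_id_eq h1 h2, if_pos heq, phiA_eq_prod_image hf1, phiA_eq_prod_image hf2, ← heq,
    Finset.abs_prod, ← Finset.prod_mul_distrib, ← Finset.prod_div_distrib]
  refine Finset.prod_congr rfl fun p hp => ?_
  obtain ⟨x, hx, rfl⟩ := Finset.mem_image.1 hp
  have h2' : (2:ℝ) ≤ x.1 := by exact_mod_cast (prime_of_mem_tuples (tuplesProd_subset h1) hx).two_le
  have hpos : 0 < (x.1 : ℝ) - 1 := by linarith
  split_ifs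
  · rw [abs_of_pos hpos]; field_simp
  · rw [abs_neg, abs_one]; field_simp

/-- **Lemma 5.1 in the `y`-variables** (Maynard 2015, (5.15)): for `D₀ ≥ 8k²` and `|y| ≤ Y`,
`|Σ'₁ − ∑_A y_A²/φ(A)| ≤ Y² (8k²/D₀) ∑_A 1/φ(A)`. [cite: MaynardAnnals2015, Lemma 5.1, (5.15)] -/
theorem abs_mainSum1_sub_diag_le [NeZero k] (hD : 8 * k ^ 2 ≤ D₀) {y : Finset (ℕ × Fin k) → ℝ}
    {Y : ℝ} (hY0 : 0 ≤ Y) (hY : ∀ A ∈ tuplesProd k D₀ Rn, |y A| ≤ Y) :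
    |mainSum1 D₀ Rn y - ∑ A ∈ tuplesProd k D₀ Rn, y A ^ 2 / phiA A| ≤
      Y ^ 2 * (8 * (k : ℝ) ^ 2 / D₀) * ∑ A ∈ tuplesProd k D₀ Rn, 1 / phiA A := by
  set T := tuplesProd k D₀ Rn with hT
  set t : Finset (ℕ × Fin k) × Finset (ℕ × Fin k) → ℝ :=
    fun P => y P.1 * y P.2 / (phiA P.1 * phiA P.2) * kernel (fun p => (p : ℝ)) P.1 P.2 with ht
  -- diagonal + off-diagonal
  have hsplit : mainSum1 D₀ Rn y = ∑ A ∈ T, y A ^ 2 / phiA A +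
      ∑ P ∈ (eqPairs k D₀ Rn).filter (fun P => P.1 ≠ P.2), t P := by
    rw [mainSum1_eq_sum_kernel, ← hT, ← Finset.sum_product' (f := fun A A' =>
      y A * y A' / (phiA A * phiA A') * kernel (fun p => (p : ℝ)) A A'),
      ← Finset.sum_filter_add_sum_filter_not (T ×ˢ T) (fun P => P.1 = P.2)]
    congr 1
    · -- the diagonal
      refine Finset.sum_nbij' (fun P => P.1) (fun A => (A, A)) ?_ ?_ ?_ ?_ ?_
      · intro P hP; exact (Finset.mem_product.1 (Finset.mem_filter.1 hP).1).1
      · intro A hA; exact Finset.mem_filter.2 ⟨Finset.mem_product.2 ⟨hA, hA⟩, rfl⟩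
      · intro P hP
        exact Prod.ext rfl (Finset.mem_filter.1 hP).2
      · intro A _; rfl
      · intro P hP
        obtain ⟨hP', heq⟩ := Finset.mem_filter.1 hP
        have hA := (Finset.mem_product.1 hP').1
        show y P.1 * y P.2 / (phiA P.1 * phiA P.2) * kernel (fun p => (p : ℝ)) P.1 P.2 = y P.1 ^ 2 / phiA P.1
        rw [← heq, kernel_id_self hA]
        have := (phiA_pos fun x hx => prime_of_mem_tuples (tuplesProd_subset hA) hx).ne'
        field_simp
    · -- the off-diagonal: only pairs with the same primes contribute
      have hvan : ∀ P ∈ (T ×ˢ T).filter (fun P => ¬P.1 = P.2), t P ≠ 0 →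
          P.1.image Prod.fst = P.2.image Prod.fst := by
        intro P hP hne
        by_contra hfst
        apply hne
        obtain ⟨hP', _⟩ := Finset.mem_filter.1 hP
        obtain ⟨h1, h2⟩ := Finset.mem_product.1 hP'
        simp only [ht, kernel_id_eq h1 h2, if_neg hfst, mul_zero]
      rw [← Finset.sum_filter_of_ne hvan, Finset.filter_filter, eqPairs, Finset.filter_filter, ← hT]
      refine Finset.sum_congr (Finset.filter_congr fun P _ => ?_) fun _ _ => rfl
      exact ⟨fun h => ⟨h.2, h.1⟩, fun h => ⟨h.2, h.1⟩⟩
  rw [hsplit, add_sub_cancel_left]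
  -- bound the off-diagonal termwise by `Y² offW`
  calc |∑ P ∈ (eqPairs k D₀ Rn).filter (fun P => P.1 ≠ P.2), t P|
      ≤ ∑ P ∈ (eqPairs k D₀ Rn).filter (fun P => P.1 ≠ P.2), |t P| := Finset.abs_sum_le_sum_abs _ _
    _ ≤ ∑ P ∈ (eqPairs k D₀ Rn).filter (fun P => P.1 ≠ P.2), Y ^ 2 * offW P := by
        refine Finset.sum_le_sum fun P hP => ?_
        have hP' := (Finset.mem_filter.1 hP).1
        obtain ⟨h1, h2, _⟩ := mem_eqPairs.1 hP'
        have hφ1 := phiA_pos fun x hx => prime_of_mem_tuples (tuplesProd_subset h1) hx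
        have hφ2 := phiA_pos fun x hx => prime_of_mem_tuples (tuplesProd_subset h2) hx
        rw [ht]
        dsimp only
        rw [abs_mul, abs_div, abs_mul, abs_mul, abs_of_pos hφ1, abs_of_pos hφ2, ← abs_kernel_div_eq_offW hP',
          sq]
        have := hY P.1 h1
        have := hY P.2 h2
        have hK := abs_nonneg (kernel (fun p => (p : ℝ)) P.1 P.2)
        rw [← mul_div_assoc, div_mul_eq_mul_div]
        exact div_le_div_of_nonneg_right
          (mul_le_mul_of_nonneg_right (mul_le_mul (hY P.1 h1) (hY P.2 h2) (abs_nonneg _) hY0) hK)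
          (mul_pos hφ1 hφ2).le
    _ = Y ^ 2 * ∑ P ∈ (eqPairs k D₀ Rn).filter (fun P => P.1 ≠ P.2), offW P := by rw [Finset.mul_sum]
    _ ≤ Y ^ 2 * (8 * (k : ℝ) ^ 2 / D₀ * ∑ A ∈ T, 1 / phiA A) := by
        gcongr; exact sum_offW_le hD
    _ = _ := by ring

/-- `(∏B)/φ(A) ≤ 2^{|B|}` for a divisor tuple `B ⊆ A`. [folklore] -/
theorem prodA_div_phiA_le {A B : Finset (ℕ × Fin k)} (hp : ∀ x ∈ A, x.1.Prime) (hB : B ⊆ A) :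
    prodA B / phiA A ≤ (2:ℝ) ^ B.card := by
  have hφ : phiA A = phiA B * phiA (A \ B) := by
    rw [← phiA_union Finset.disjoint_sdiff, Finset.union_sdiff_of_subset hB]
  have hφB := phiA_pos fun x hx => hp x (hB hx)
  have hφD := phiA_pos (A := A \ B) fun x hx => hp x (Finset.sdiff_subset hx)
  rw [hφ, div_le_iff₀ (mul_pos hφB hφD)]
  have h1 : prodA B ≤ (2:ℝ) ^ B.card * phiA B := by
    rw [prodA, phiA, Finset.pow_card_mul_prod]
    refine Finset.prod_le_prod (fun x _ => by positivity) fun x hx => ?_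
    have : (2:ℝ) ≤ x.1 := by exact_mod_cast (hp x (hB hx)).two_le
    linarith
  have h2 : (1:ℝ) ≤ phiA (A \ B) := by
    rw [phiA]
    refine Finset.prod_induction _ (fun r : ℝ => 1 ≤ r) (fun a b ha hb => by nlinarith) le_rfl ?_
    intro x hx
    have : (2:ℝ) ≤ x.1 := by exact_mod_cast (hp x (Finset.sdiff_subset hx)).two_le
    show (1:ℝ) ≤ x.1 - 1
    linarith
  have h3 : (2:ℝ) ^ B.card * phiA B ≤ (2:ℝ) ^ B.card * (phiA B * phiA (A \ B)) := by
    rw [← mul_assoc]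
    exact le_mul_of_one_le_right (by positivity) h2
  exact h1.trans h3

/-- **`∑_d |λ_d| ≤ y_max R (1 + log R)^{3k−1}`** (Maynard 2015, (5.4), (5.9): the error term of
Lemma 5.1 is `O(λ_max² R² (log R)^{2k})`). [cite: MaynardAnnals2015, proof of Lemma 5.1, (5.4), (5.9)] -/
theorem sum_abs_lam_le [NeZero k] {y : Finset (ℕ × Fin k) → ℝ} {Y : ℝ} (hY0 : 0 ≤ Y)
    (hY : ∀ A ∈ tuplesProd k D₀ Rn, |y A| ≤ Y) :
    ∑ B ∈ tuplesProd k D₀ Rn, |lam D₀ Rn y B| ≤ Y * (Rn * (1 + Real.log Rn) ^ (3 * k - 1)) := by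
  set T := tuplesProd k D₀ Rn with hT
  have hk : 1 ≤ 3 * k := by have := Nat.pos_of_ne_zero (NeZero.ne k); omega
  calc ∑ B ∈ T, |lam D₀ Rn y B|
      ≤ ∑ B ∈ T, ∑ A ∈ T.filter (fun A => B ⊆ A), Y * (prodA B / phiA A) := by
        refine Finset.sum_le_sum fun B hB => ?_
        have hpB : 0 ≤ prodA B := (prodA_pos fun x hx => prime_of_mem_tuples (tuplesProd_subset hB) hx).le
        rw [lam, abs_mul, abs_mul, abs_pow, abs_neg, abs_one, one_pow, one_mul, abs_of_nonneg hpB]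
        calc prodA B * |∑ A ∈ T.filter (fun A => B ⊆ A), y A / phiA A|
            ≤ prodA B * ∑ A ∈ T.filter (fun A => B ⊆ A), |y A / phiA A| := by
              gcongr; exact Finset.abs_sum_le_sum_abs _ _
          _ = ∑ A ∈ T.filter (fun A => B ⊆ A), prodA B * |y A / phiA A| := by rw [Finset.mul_sum]
          _ ≤ _ := Finset.sum_le_sum fun A hA => by
              have hA' := (Finset.mem_filter.1 hA).1
              have hφ := phiA_pos fun x hx => prime_of_mem_tuples (tuplesProd_subset hA') hx
              rw [abs_div, abs_of_pos hφ]
              calc prodA B * (|y A| / phiA A) = prodA B / phiA A * |y A| := by ring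
                _ ≤ prodA B / phiA A * Y := mul_le_mul_of_nonneg_left (hY A hA') (div_nonneg hpB hφ.le)
                _ = Y * (prodA B / phiA A) := by ring
    _ = ∑ A ∈ T, ∑ B ∈ A.powerset, Y * (prodA B / phiA A) := sum_tuplesProd_sum_superset _
    _ ≤ ∑ A ∈ T, ∑ B ∈ A.powerset, Y * (2:ℝ) ^ B.card := by
        refine Finset.sum_le_sum fun A hA => Finset.sum_le_sum fun B hB => ?_
        gcongr
        exact prodA_div_phiA_le (fun x hx => prime_of_mem_tuples (tuplesProd_subset hA) hx)
          (Finset.mem_powerset.1 hB)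
    _ = Y * ∑ A ∈ T, (3:ℝ) ^ A.card := by
        rw [Finset.mul_sum]
        refine Finset.sum_congr rfl fun A _ => ?_
        rw [← Finset.mul_sum, sum_powerset_two_pow]
    _ ≤ Y * (prodLeTuples (3 * k) Rn).card := by gcongr; exact sum_tuplesProd_three_pow_le
    _ ≤ Y * (Rn * (1 + Real.log Rn) ^ (3 * k - 1)) := by gcongr; exact card_prodLeTuples_le _ hk Rn

/-- **Lemma 5.1** (Maynard 2015), tree form: with `W = D₀#`, `D₀ ≥ 8k²`, shifts `hᵢ` distinct with
differences `≤ D₀`, and `|y| ≤ Y` on the support tuples,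
`|S₁ − (N/W) ∑_A y_A²/φ(A)| ≤ (N/W) Y² (8k²/D₀) ∑_A 1/φ(A) + Y² R² (1 + log R)^{6k−2}`.
(In print: `S₁ = (N/W) ∑ y²/∏φ + O(y_max² N (log R)^k/(W D₀) + y_max² R² (log R)^{4k})`.)
[cite: MaynardAnnals2015, Lemma 5.1] -/
theorem abs_S1_sub_main_le [NeZero k] (hh : ShiftHyp k D₀ h) (hD : 8 * k ^ 2 ≤ D₀)
    {y : Finset (ℕ × Fin k) → ℝ} {Y : ℝ} (hY0 : 0 ≤ Y) (hY : ∀ A ∈ tuplesProd k D₀ Rn, |y A| ≤ Y) :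
    |S1 D₀ Rn (primorial D₀) N v₀ y h -
        (N : ℝ) / primorial D₀ * ∑ A ∈ tuplesProd k D₀ Rn, y A ^ 2 / phiA A| ≤
      (N : ℝ) / primorial D₀ * (Y ^ 2 * (8 * (k : ℝ) ^ 2 / D₀) * ∑ A ∈ tuplesProd k D₀ Rn, 1 / phiA A) +
        (Y * (Rn * (1 + Real.log Rn) ^ (3 * k - 1))) ^ 2 := by
  have h1 := abs_S1_sub_mainSum1_le (N := N) (v₀ := v₀) hh y (Rn := Rn)
  have h2 := abs_mainSum1_sub_diag_le hD hY0 hY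
  have h3 := sum_abs_lam_le (D₀ := D₀) (Rn := Rn) hY0 hY
  have hNW : 0 ≤ (N : ℝ) / primorial D₀ := by positivity
  have h2' : |(N : ℝ) / primorial D₀ * mainSum1 D₀ Rn y -
      (N : ℝ) / primorial D₀ * ∑ A ∈ tuplesProd k D₀ Rn, y A ^ 2 / phiA A| ≤
      (N : ℝ) / primorial D₀ * (Y ^ 2 * (8 * (k : ℝ) ^ 2 / D₀) * ∑ A ∈ tuplesProd k D₀ Rn, 1 / phiA A) := by
    rw [← mul_sub, abs_mul, abs_of_nonneg hNW]
    exact mul_le_mul_of_nonneg_left h2 hNW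
  have h3' : (∑ B ∈ tuplesProd k D₀ Rn, |lam D₀ Rn y B|) ^ 2 ≤
      (Y * (Rn * (1 + Real.log Rn) ^ (3 * k - 1))) ^ 2 :=
    pow_le_pow_left₀ (Finset.sum_nonneg fun _ _ => abs_nonneg _) h3 2
  calc _ ≤ |S1 D₀ Rn (primorial D₀) N v₀ y h - (N : ℝ) / primorial D₀ * mainSum1 D₀ Rn y| +
        |(N : ℝ) / primorial D₀ * mainSum1 D₀ Rn y -
          (N : ℝ) / primorial D₀ * ∑ A ∈ tuplesProd k D₀ Rn, y A ^ 2 / phiA A| := abs_sub_le _ _ _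
    _ ≤ _ := by linarith

end Conclusion

end MaynardTao
end Literature.NumberTheory.Sieve
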